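import Summits.AtomisticToContinuum.HydrodynamicLimit.Theorems.TwoClocksClampedWindowDockTimeZero
import Summits.AtomisticToContinuum.HydrodynamicLimit.Theorems.TwoClocksClampedWindowDockActivityInversion
import Summits.AtomisticToContinuum.HydrodynamicLimit.Theorems.TwoClocksClampedWindowDockReferenceLLN
import Literature.Analysis.FunctionSpaces.TorusCalculusProofs

/-!
# The entropy clock `ClampedWindowDock` (stmt-AtomisticToContinuum-13735), IV: reduction to the relative-entropy estimate along an explicit reference

Parts I–III discharge every clause of the consequent `RelEntropyVanishing` of the dock except Yau's
relative-entropy estimate itself. This file assembles them: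

* `clampedWindowDock_of_gronwall` — `ClampedWindowDock` follows from its GRONWALL CORE: given the matrix of
  `UniformLocalGibbsConcentration` at some `η₀` and the six other antecedents, for continuous positive
  profiles there is `σ₀ > 0` such that for `0 < σ < σ₀`, every classical solution `(ρ, u, θ)` on `[0, T)` tied
  at `t = 0`, every flow family `Φ`, every `t ∈ (0, T)` and every activity `a` HANDED OVER with
  `ρ_t ≤ a ≤ 2ρ_t`, `SmallDensity (profileOf a) σ` and `rhoLim (profileOf a) σ = ρ_t` (such an `a` exists:
  `exists_activity_of_density`, part II, at packing `σ³ sup ρ_t ≤ η₁` — guaranteed here through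
  `DiluteSelfConsistency`), the specific relative entropy of the true law with respect to the local Gibbs law
  of `(a, u_t, θ_t)` vanishes: `KL(lawAt Φ λ_N t ‖ localGibbsLaw σ a (u t) (θ t) N (Φ N))/(N+1) → 0`.

The reduction uses: the `t = 0` slice and the reference bookkeeping (`clampedWindowDock_of_core`, part I), the
activity inversion (part II), the reference tie at fixed `σ` (`tie_rhoLim_of_smallDensity`, part III), mass
conservation and unit admissible mass (`integral_density_eq`, `integral_density_zero_eq_one`, re-proved here from
the negative file of crux DenseExcursion to keep the imports within Literature and this route), and
`DiluteSelfConsistency` at `η = min η₁ (η₀/2)` for the packing of `ρ_t`.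

prover-pitem-stmt-AtomisticToContinuum-13735-0.  MAINTENANCE RECORD (full-build repair 2026-08-17, after the repair
p134718 of part I): route rev 10 (2026-08-16T20:17Z) DROPPED `ClampedWindowDock` (stmt-13735) and REPLACED its collisional
pair `EquilibriumClampedCollisionalWindowLD` (stmt-13733, refuted in Lean) / `CollisionActivityTails` (stmt-13734) by
`ClampedTransferWindowLD` (stmt-16623) / `TransferActivityTails` (stmt-16624). Exactly as in part I, the two reductions
are transcribed VERBATIM over the repaired pair (their proofs never inspect the pair), the dock being spelled out as the
chain to `RelEntropyVanishing` that `relEntropyDock_of_core` (part I) concludes; new names `relEntropyDock_of_gronwallRf`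
/ `relEntropyDock_of_gronwall`, the rev-4 names kept as deprecated aliases.
-/

noncomputable section

namespace Summit.AtomisticToContinuum.HydrodynamicLimit.Theorems.EntropyClockDock

open MeasureTheory Filter Set Topology InformationTheory
open scoped ENNReal
open Literature.MathematicalPhysics.KineticTheory Literature.Analysis.FluidPDE Literature.Analysis.FunctionSpaces
open Summit.AtomisticToContinuum.HydrodynamicLimit.Theses.TwoClocks

/-! ### §1 Mass conservation and unit admissible mass (PRIVATE re-proofs) -/

-- adapted from `DenseExcursionEverywhere.integral_density_eq` (Theorems/DenseExcursion/Negative/Everywhere.lean)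
/-- **Mass is conserved** along every classical hard-sphere-Euler solution: `∫ ρ(t) = ∫ ρ(0)` on `[0, T)` (only
the continuity equation is integrated, `∫ div = 0` on the torus). [folklore] -/
private theorem integral_density_eq {σ T : ℝ} {ρ θ : ℝ → T3 → ℝ} {u : ℝ → T3 → V3}
    (hE : IsHardSphereEulerSolution σ T ρ u θ) {t : ℝ} (ht : t ∈ Ico 0 T) :
    ∫ x, ρ t x = ∫ x, ρ 0 x := by
  have hderiv : ∀ s ∈ Ico 0 T, HasDerivWithinAt (fun s => ∫ x, ρ s x) 0 (Ico 0 T) s := by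
    intro s hs
    have h1 := hE.smooth_density.hasDerivWithinAt_integral (convex_Ico 0 T) hs
    have h2 : ∫ x, Torus.timeDerivWithin (Ico 0 T) ρ s x = 0 := by
      have hpt : (fun x => Torus.timeDerivWithin (Ico 0 T) ρ s x) =
          fun x => -Torus.divergence (fun y => ρ s y • u s y) x := by
        funext x; have := hE.mass s hs x; linarith
      rw [hpt, integral_neg, neg_eq_zero]
      exact Torus.integral_divergence_eq_zero_holds
        ((hE.smooth_density.smul hE.smooth_velocity).isSmooth_slice hs)
    rwa [h2] at h1
  have hcont : ContinuousOn (fun s => ∫ x, ρ s x) (Icc 0 t) := fun s hs =>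
    ((hderiv s ⟨hs.1, hs.2.trans_lt ht.2⟩).continuousWithinAt).mono (Icc_subset_Ico_right ht.2)
  have hright : ∀ s ∈ Ico 0 t, HasDerivWithinAt (fun s => ∫ x, ρ s x) 0 (Ici s) s := by
    intro s hs
    have hsT : s ∈ Ico 0 T := ⟨hs.1, hs.2.trans ht.2⟩
    refine (hderiv s hsT).mono_of_mem_nhdsWithin ?_
    exact Filter.mem_of_superset (Ico_mem_nhdsGE hsT.2) (Ico_subset_Ico_left hsT.1)
  exact constant_of_has_deriv_right_zero hcont hright t (right_mem_Icc.2 ht.1)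

-- adapted from `DenseExcursionEverywhere.integral_density_zero_eq_one` (ibid.)
/-- **Admissible mass is one**: the `t = 0` tie tested with `χ ≡ 1` (empirical density identically `1`, laws of
total mass `1` for `σ ≤ 1/2`) forces `∫ ρ(0) = 1`. [folklore] -/
private theorem integral_density_zero_eq_one {σ : ℝ} (hσ2 : σ ≤ 1 / 2) {a₀ θ₀ : T3 → ℝ} {u₀ : T3 → V3}
    (ha : Continuous a₀) (hθ : Continuous θ₀) (hu : Continuous u₀) (ha0 : ∀ x, 0 < a₀ x)
    (hθ0 : ∀ x, 0 < θ₀ x) {ρ θ : ℝ → T3 → ℝ} {u : ℝ → T3 → V3}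
    (Φ : (N : ℕ) → HardSphereFlow (Torus.geometry (Fin 3)) (hsDiameter σ N) (N + 1))
    (hA : TendstoHydroFieldsAt (fun N => localGibbsLaw σ a₀ u₀ θ₀ N (Φ N)) Φ ρ u θ 0) :
    ∫ x, ρ 0 x = 1 := by
  by_contra hne
  have hd : 0 < |1 - ∫ x, ρ 0 x| := abs_pos.2 (sub_ne_zero.2 (Ne.symm hne))
  have h := (hA (fun _ => 1) continuous_const (|1 - ∫ x, ρ 0 x| / 2) (by positivity)).1
  have hev : ∀ N : ℕ, {z : Config (N + 1) (Fin 3) T3 | |1 - ∫ x, ρ 0 x| / 2 <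
      |empiricalDensityField ((Φ N).flow 0 z) (fun _ => 1) - ∫ x, (fun _ => (1 : ℝ)) x * ρ 0 x|} = univ := by
    intro N
    ext z
    simp only [mem_setOf_eq, mem_univ, iff_true, empiricalDensityField_one (Nat.succ_ne_zero N), one_mul]
    linarith
  have hP : ∀ N, IsProbabilityMeasure (localGibbsLaw σ a₀ u₀ θ₀ N (Φ N)) :=
    fun N => isProbabilityMeasure_localGibbsLaw ha hθ hu ha0 hθ0 hσ2 N (Φ N)
  simp only [hev, measure_univ] at h
  exact one_ne_zero (tendsto_nhds_unique (tendsto_const_nhds (x := (1 : ℝ≥0∞)) (f := atTop)) h)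

/-! ### §2 The reduction -/

/-- **`ClampedWindowDock` reduces to Yau's relative-entropy estimate along the EXPLICIT reference family.** The
hypothesis `gronwall` is the dock with its consequent replaced by the single clause
`KL(lawAt Φ λ_N t ‖ localGibbsLaw σ a_t (u t) (θ t))/(N+1) → 0` for `t ∈ (0, T)`, where
`a_t := fun x => ρ t x · Rf(σ³ ρ t x)` for ANY insertion factor `Rf` on `(-r, r)` (handed over with its four
defining properties; `stub_eosRatioAnalytic` provides an analytic one, so `s ↦ a_s` is as smooth in `s` as the
Euler density — the reference family of the clock), together with the facts `ρ_t ≤ a_t ≤ 2ρ_t`,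
`SmallDensity (profileOf a_t) σ`, `rhoLim (profileOf a_t) σ = ρ_t` (available as hypotheses; they hold by
`activity_of_density`). What the hypothesis still has to prove are steps (i)–(vi) of the informal proof (entropy
production identity, Euler cancellation, localisation of the clamped collisional window LD, window averaging,
large-deviation transfer at fixed `β`, order of limits). Transcribed 2026-08-17 over the rev-10 collisional pair
`ClampedTransferWindowLD` / `TransferActivityTails`, the dock spelled out as the chain to `RelEntropyVanishing`
concluded by `relEntropyDock_of_core` (rev-4 name: `clampedWindowDock_of_gronwallRf`). [folklore] -/
theorem relEntropyDock_of_gronwallRf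
    (gronwall : ∀ (r : ℝ) (Rf : ℝ → ℝ), 0 < r →
      (∀ x ∈ Ioo (-r) r, 0 < Rf x ∧ Rf x * (∑' j : ℕ, bE j / (j.factorial : ℝ) * (x * Rf x) ^ j) = 1) →
      (∀ x ∈ Icc 0 r, 1 ≤ Rf x ∧ Rf x ≤ 2) → ContinuousOn Rf (Icc 0 r) →
      (∀ x ∈ Ioo (-r) r, ∀ R ∈ Icc (1 / 2 : ℝ) 2,
        R * (∑' j : ℕ, bE j / (j.factorial : ℝ) * (x * R) ^ j) = 1 → R = Rf x) →
      ∀ η₀ : ℝ, 0 < η₀ →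
      (∀ (a θ₀ : T3 → ℝ) (u₀ : T3 → V3), Continuous a → Continuous θ₀ → Continuous u₀ → (∀ x, 0 < a x) →
        (∀ x, 0 < θ₀ x) → ∀ σ : ℝ, 0 < σ → σ ^ 3 * (⨆ x, a x) ≤ η₀ * ∫ x, a x →
        ∃ ρ₀ : T3 → ℝ, Continuous ρ₀ ∧ (∀ x, 0 < ρ₀ x) ∧
          (∀ (N : ℕ) (Φ : HardSphereFlow (Torus.geometry (Fin 3)) (hsDiameter σ N) (N + 1)),
            IsProbabilityMeasure (localGibbsLaw σ a u₀ θ₀ N Φ)) ∧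
          ∀ χ : T3 → ℝ, Continuous χ → ∀ δ : ℝ, 0 < δ → ∃ C : ℝ, 0 < C ∧
            ∀ (N : ℕ) (Φ : HardSphereFlow (Torus.geometry (Fin 3)) (hsDiameter σ N) (N + 1)),
              localGibbsLaw σ a u₀ θ₀ N Φ {z | δ < |empiricalDensityField z χ - ∫ x, χ x * ρ₀ x|} ≤
                  ENNReal.ofReal (C * Real.exp (-(C⁻¹ * ((N : ℝ) + 1)))) ∧
                localGibbsLaw σ a u₀ θ₀ N Φ
                    {z | δ < ‖empiricalMomentumField z χ - ∫ x, (χ x * ρ₀ x) • u₀ x‖} ≤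
                  ENNReal.ofReal (C * Real.exp (-(C⁻¹ * ((N : ℝ) + 1)))) ∧
                localGibbsLaw σ a u₀ θ₀ N Φ {z | δ < |empiricalEnergyField z χ -
                    ∫ x, χ x * totalEnergyDensity (ρ₀ x) (u₀ x) (θ₀ x)|} ≤
                  ENNReal.ofReal (C * Real.exp (-(C⁻¹ * ((N : ℝ) + 1))))) →
      KineticWindowLDUniform → ClampedTransferWindowLD → TransferActivityTails →
      EnergyCurrentTails → HsEosLowDensity → DiluteSelfConsistency →
      ∀ (a₀ θ₀ : T3 → ℝ) (u₀ : T3 → V3), Continuous a₀ → Continuous θ₀ → Continuous u₀ →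
        (∀ x, 0 < a₀ x) → (∀ x, 0 < θ₀ x) →
        ∃ σ₀ : ℝ, 0 < σ₀ ∧ ∀ σ : ℝ, 0 < σ → σ < σ₀ →
          ∀ (T : ℝ) (ρ θ : ℝ → T3 → ℝ) (u : ℝ → T3 → V3), IsHardSphereEulerSolution σ T ρ u θ →
            ∀ Φ : (N : ℕ) → HardSphereFlow (Torus.geometry (Fin 3)) (hsDiameter σ N) (N + 1),
              TendstoHydroFieldsAt (fun N => localGibbsLaw σ a₀ u₀ θ₀ N (Φ N)) Φ ρ u θ 0 →
              ∀ t ∈ Set.Ioo 0 T, ∀ (hac : Continuous fun x => ρ t x * Rf (σ ^ 3 * ρ t x))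
                (hap : ∀ x, 0 < ρ t x * Rf (σ ^ 3 * ρ t x)),
                (∀ x, ρ t x ≤ ρ t x * Rf (σ ^ 3 * ρ t x) ∧ ρ t x * Rf (σ ^ 3 * ρ t x) ≤ 2 * ρ t x) →
                SmallDensity (profileOf (fun x => ρ t x * Rf (σ ^ 3 * ρ t x)) hac hap) σ →
                rhoLim (profileOf (fun x => ρ t x * Rf (σ ^ 3 * ρ t x)) hac hap) σ = ρ t →
                Tendsto (fun N : ℕ => klDiv ((Φ N).lawAt (localGibbsLaw σ a₀ u₀ θ₀ N (Φ N)) t)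
                  (localGibbsLaw σ (fun x => ρ t x * Rf (σ ^ 3 * ρ t x)) (u t) (θ t) N (Φ N)) /
                    ((N : ℝ≥0∞) + 1)) atTop (𝓝 0)) :
    KineticWindowLDUniform → ClampedTransferWindowLD → TransferActivityTails → EnergyCurrentTails →
      UniformLocalGibbsConcentration → HsEosLowDensity → DiluteSelfConsistency → RelEntropyVanishing := by
  obtain ⟨r, hr, Rf, -, -, -, hsol, hbd, hLip, huniq⟩ := stub_eosRatioAnalytic
  have hcont : ContinuousOn Rf (Icc 0 r) := by
    obtain ⟨L, hL⟩ := hLip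
    exact hL.continuousOn
  refine relEntropyDock_of_core fun η₀ hη₀ HU hK h₃ h₇ h₆ hEos hS a₀ θ₀ u₀ ha hθ hu ha0 hθ0 => ?_
  obtain ⟨σc, hσc, Hc⟩ :=
    gronwall r Rf hr hsol hbd hcont huniq η₀ hη₀ HU hK h₃ h₇ h₆ hEos hS a₀ θ₀ u₀ ha hθ hu ha0 hθ0
  -- the packing threshold of `activity_of_density`
  set η₁ : ℝ := min (r / (2 * (2 * (2 * Real.exp 1 + 1)))) (1 / (64 * Real.exp 1 * v₁)) with hη₁
  have hη₁ : 0 < η₁ := lt_min (by positivity) (by have := v₁_pos; positivity)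
  -- dilute self-consistency at `η = min η₁ (η₀/2)`
  obtain ⟨σd, hσd, Hd⟩ := hS (min η₁ (η₀ / 2)) (lt_min hη₁ (by positivity)) a₀ θ₀ u₀ ha hθ hu ha0 hθ0
  refine ⟨min σc (min σd (1 / 2)), lt_min hσc (lt_min hσd (by norm_num)), fun σ hσ hσlt T ρ θ u hE Φ htie t ht => ?_⟩
  have hσc' : σ < σc := hσlt.trans_le (min_le_left _ _)
  have hσd' : σ < σd := hσlt.trans_le ((min_le_right _ _).trans (min_le_left _ _))
  have hσ2' : σ < 1 / 2 := hσlt.trans_le ((min_le_right _ _).trans (min_le_right _ _))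
  have hσ2 : σ ≤ 1 / 2 := hσ2'.le
  have htI : t ∈ Ico 0 T := ⟨ht.1.le, ht.2⟩
  -- the Euler slice at time `t`
  have hρtc : Continuous (ρ t) := (hE.smooth_density.isSmooth_slice htI).continuous
  have hutc : Continuous (u t) := (hE.smooth_velocity.isSmooth_slice htI).continuous
  have hθtc : Continuous (θ t) := (hE.smooth_temperature.isSmooth_slice htI).continuous
  have hρtpos : ∀ x, 0 < ρ t x := hE.density_pos t htI
  have hθtpos : ∀ x, 0 < θ t x := hE.temperature_pos t htI
  have hmass : ∫ x, ρ t x = 1 :=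
    (integral_density_eq hE htI).trans (integral_density_zero_eq_one hσ2 ha hθ hu ha0 hθ0 Φ htie)
  -- packing of `ρ_t` from dilute self-consistency
  have hpack : ∀ x, ρ t x * σ ^ 3 < min η₁ (η₀ / 2) := fun x => Hd σ hσ hσd' T ρ θ u hE Φ htie t htI x
  have hbdd : BddAbove (Set.range (ρ t)) := (isCompact_range hρtc).bddAbove
  obtain ⟨xM, -, hxM⟩ := isCompact_univ.exists_isMaxOn univ_nonempty hρtc.continuousOn
  have hsup : (⨆ x, ρ t x) = ρ t xM :=
    le_antisymm (ciSup_le fun x => (isMaxOn_iff.mp hxM) x (mem_univ x)) (le_ciSup hbdd xM)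
  have hpack₁ : σ ^ 3 * (⨆ x, ρ t x) ≤ η₁ := by
    rw [hsup, mul_comm]; exact ((hpack xM).trans_le (min_le_left _ _)).le
  have hpack₀ : σ ^ 3 * (⨆ x, ρ t x) ≤ η₀ / 2 := by
    rw [hsup, mul_comm]; exact ((hpack xM).trans_le (min_le_right _ _)).le
  -- the inverted activity `a_t = ρ_t · Rf(σ³ ρ_t)`
  obtain ⟨hac, hap, hale, hQs, hlim⟩ :=
    activity_of_density hr hsol hbd hcont huniq hσ hσ2' hρtc hρtpos hmass hpack₁
  refine ⟨_, hac, hap, ?_, ?_, Hc σ hσ hσc' T ρ θ u hE Φ htie t ht hac hap hale hQs hlim⟩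
  · -- `η₀`-diluteness of `a_t`: `σ³ sup a_t ≤ 2 σ³ sup ρ_t ≤ η₀ ≤ η₀ ∫a_t`
    have hsupa : (⨆ x, ρ t x * Rf (σ ^ 3 * ρ t x)) ≤ 2 * ⨆ x, ρ t x :=
      ciSup_le fun x => (hale x).2.trans (mul_le_mul_of_nonneg_left (le_ciSup hbdd x) zero_le_two)
    have hinta : 1 ≤ ∫ x, ρ t x * Rf (σ ^ 3 * ρ t x) := by
      have h := integral_mono (integrable_of_continuous_T3 hρtc) (integrable_of_continuous_T3 hac)
        fun x => (hale x).1
      linarith [hmass]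
    have hσ3 : 0 ≤ σ ^ 3 := by positivity
    calc σ ^ 3 * (⨆ x, ρ t x * Rf (σ ^ 3 * ρ t x)) ≤ σ ^ 3 * (2 * ⨆ x, ρ t x) :=
          mul_le_mul_of_nonneg_left hsupa hσ3
      _ = 2 * (σ ^ 3 * ⨆ x, ρ t x) := by ring
      _ ≤ 2 * (η₀ / 2) := by gcongr
      _ = η₀ * 1 := by ring
      _ ≤ η₀ * ∫ x, ρ t x * Rf (σ ^ 3 * ρ t x) := mul_le_mul_of_nonneg_left hinta hη₀.le
  · -- the reference tie: `rhoLim (profileOf a_t) σ = ρ_t`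
    have h := tie_rhoLim_of_smallDensity (u₀ := u t) hac hθtc hutc hap hθtpos hσ2 hQs Φ
    simp only [hlim] at h
    exact h

/-- DEPRECATED rev-4 name (concluded the dropped route decl `ClampedWindowDock`, stmt-13735, over the rev-4 collisional
pair). [folklore] -/
@[deprecated relEntropyDock_of_gronwallRf (since := "2026-08-17")]
alias clampedWindowDock_of_gronwallRf := relEntropyDock_of_gronwallRf

/-- **The entropy-target dock reduces to Yau's relative-entropy estimate along any handed-over reference** (corollary
of `relEntropyDock_of_gronwallRf`: an activity-agnostic hypothesis — for `t ∈ (0,T)` and EVERY continuous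
positive `a` with `ρ_t ≤ a ≤ 2ρ_t`, `SmallDensity (profileOf a) σ`, `rhoLim (profileOf a) σ = ρ_t`, the specific
relative entropy vanishes — is in particular the explicit-reference hypothesis). Transcribed 2026-08-17 over the
rev-10 collisional pair `ClampedTransferWindowLD` / `TransferActivityTails`, the dock spelled out as the chain to
`RelEntropyVanishing` (rev-4 name: `clampedWindowDock_of_gronwall`). [folklore] -/
theorem relEntropyDock_of_gronwall
    (gronwall : ∀ η₀ : ℝ, 0 < η₀ →
      (∀ (a θ₀ : T3 → ℝ) (u₀ : T3 → V3), Continuous a → Continuous θ₀ → Continuous u₀ → (∀ x, 0 < a x) →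
        (∀ x, 0 < θ₀ x) → ∀ σ : ℝ, 0 < σ → σ ^ 3 * (⨆ x, a x) ≤ η₀ * ∫ x, a x →
        ∃ ρ₀ : T3 → ℝ, Continuous ρ₀ ∧ (∀ x, 0 < ρ₀ x) ∧
          (∀ (N : ℕ) (Φ : HardSphereFlow (Torus.geometry (Fin 3)) (hsDiameter σ N) (N + 1)),
            IsProbabilityMeasure (localGibbsLaw σ a u₀ θ₀ N Φ)) ∧
          ∀ χ : T3 → ℝ, Continuous χ → ∀ δ : ℝ, 0 < δ → ∃ C : ℝ, 0 < C ∧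
            ∀ (N : ℕ) (Φ : HardSphereFlow (Torus.geometry (Fin 3)) (hsDiameter σ N) (N + 1)),
              localGibbsLaw σ a u₀ θ₀ N Φ {z | δ < |empiricalDensityField z χ - ∫ x, χ x * ρ₀ x|} ≤
                  ENNReal.ofReal (C * Real.exp (-(C⁻¹ * ((N : ℝ) + 1)))) ∧
                localGibbsLaw σ a u₀ θ₀ N Φ
                    {z | δ < ‖empiricalMomentumField z χ - ∫ x, (χ x * ρ₀ x) • u₀ x‖} ≤
                  ENNReal.ofReal (C * Real.exp (-(C⁻¹ * ((N : ℝ) + 1)))) ∧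
                localGibbsLaw σ a u₀ θ₀ N Φ {z | δ < |empiricalEnergyField z χ -
                    ∫ x, χ x * totalEnergyDensity (ρ₀ x) (u₀ x) (θ₀ x)|} ≤
                  ENNReal.ofReal (C * Real.exp (-(C⁻¹ * ((N : ℝ) + 1))))) →
      KineticWindowLDUniform → ClampedTransferWindowLD → TransferActivityTails →
      EnergyCurrentTails → HsEosLowDensity → DiluteSelfConsistency →
      ∀ (a₀ θ₀ : T3 → ℝ) (u₀ : T3 → V3), Continuous a₀ → Continuous θ₀ → Continuous u₀ →
        (∀ x, 0 < a₀ x) → (∀ x, 0 < θ₀ x) →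
        ∃ σ₀ : ℝ, 0 < σ₀ ∧ ∀ σ : ℝ, 0 < σ → σ < σ₀ →
          ∀ (T : ℝ) (ρ θ : ℝ → T3 → ℝ) (u : ℝ → T3 → V3), IsHardSphereEulerSolution σ T ρ u θ →
            ∀ Φ : (N : ℕ) → HardSphereFlow (Torus.geometry (Fin 3)) (hsDiameter σ N) (N + 1),
              TendstoHydroFieldsAt (fun N => localGibbsLaw σ a₀ u₀ θ₀ N (Φ N)) Φ ρ u θ 0 →
              ∀ t ∈ Set.Ioo 0 T, ∀ (a : T3 → ℝ) (hac : Continuous a) (hap : ∀ x, 0 < a x),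
                (∀ x, ρ t x ≤ a x ∧ a x ≤ 2 * ρ t x) → SmallDensity (profileOf a hac hap) σ →
                rhoLim (profileOf a hac hap) σ = ρ t →
                Tendsto (fun N : ℕ => klDiv ((Φ N).lawAt (localGibbsLaw σ a₀ u₀ θ₀ N (Φ N)) t)
                  (localGibbsLaw σ a (u t) (θ t) N (Φ N)) / ((N : ℝ≥0∞) + 1)) atTop (𝓝 0)) :
    KineticWindowLDUniform → ClampedTransferWindowLD → TransferActivityTails → EnergyCurrentTails →
      UniformLocalGibbsConcentration → HsEosLowDensity → DiluteSelfConsistency → RelEntropyVanishing :=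
  relEntropyDock_of_gronwallRf
    fun _ Rf _ _ _ _ _ η₀ hη₀ HU hK h₃ h₇ h₆ hEos hS a₀ θ₀ u₀ ha hθ hu ha0 hθ0 => by
      obtain ⟨σ₀, hσ₀, H⟩ := gronwall η₀ hη₀ HU hK h₃ h₇ h₆ hEos hS a₀ θ₀ u₀ ha hθ hu ha0 hθ0
      exact ⟨σ₀, hσ₀, fun σ hσ hσlt T ρ θ u hE Φ htie t ht hac hap hale hQs hlim =>
        H σ hσ hσlt T ρ θ u hE Φ htie t ht (fun x => ρ t x * Rf (σ ^ 3 * ρ t x)) hac hap hale hQs hlim⟩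

/-- DEPRECATED rev-4 name (concluded the dropped route decl `ClampedWindowDock`, stmt-13735, over the rev-4 collisional
pair). [folklore] -/
@[deprecated relEntropyDock_of_gronwall (since := "2026-08-17")]
alias clampedWindowDock_of_gronwall := relEntropyDock_of_gronwall

end Summit.AtomisticToContinuum.HydrodynamicLimit.Theorems.EntropyClockDock

end
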